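import Summits.HubbardSuperconductivity.HubbardSuperconductivity.Theorems.ThermalWedgeTwSourcedInertnessLadder
import Summits.HubbardSuperconductivity.HubbardSuperconductivity.Theorems.ThermalWedgeTwSourcedInertnessReduction
import Summits.HubbardSuperconductivity.HubbardSuperconductivity.Theorems.ThermalWedgeTwSourcedCondensationFreeLinearCooperLog
import Summits.HubbardSuperconductivity.HubbardSuperconductivity.Theorems.ThermalWedgeTwSourcedCondensationFreeLinearThermalLaw
import Literature.MathematicalPhysics.QuantumLattice.GibbsPressureTemperature
import Literature.MathematicalPhysics.QuantumLattice.DWaveSourceProofs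
import Summits.HubbardSuperconductivity.HubbardSuperconductivity.Theorems.TwSourcedCondensation.Negative.NormalFormsAndFrozenThreshold

/-!
# Route `ThermalWedge`, crux `TwSourcedCondensation` (item `stmt-HubbardSuperconductivity-1697`):
# the crux holds UNCONDITIONALLY on the shallow window `|U| ≤ h²`

The crux asks, for every compact `[μ₁,μ₂] ⊂ (-4,0)`, constants `U₀ a c C h₀ > 0` such that for
`0 < U ≤ U₀`, `1 ≤ β ≤ e^{a/U}`, `μ ∈ [μ₁,μ₂]`, eventually in `L`, for `|h| ≤ h₀`:
`c h² log(1/(|h|+1/β)) − C h² ≤ p̃_L(β,U,μ,h) − p̃_L(β,U,μ,0)`,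
`p̃_L(β,U,μ,h) = log Re Z_β(dWaveSourceTorus L U μ h)/(βL²)` (the sourced torus pressure).

THEOREM (`twSourcedCondensation_shallowWindow`, this file, no `sorry`, no hypothesis). For every compact
`[μ₁,μ₂] ⊂ (-4,0)` there are `c, C > 0` such that for EVERY `β ≥ 1`, `μ ∈ [μ₁,μ₂]`, eventually in `L`
(threshold depending on `β, μ` only), for EVERY real coupling `U` and every source with
`|U| ≤ h² ≤ 1/16`:

  `c h² log(1/(|h|+1/β)) − C h² ≤ p̃_L(β,U,μ,h) − p̃_L(β,U,μ,0)`,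

with `c = c₀(μ₁,μ₂)` the FREE Cooper-logarithm constant of `stub_freeLinearCooperLog` (no loss), no
smallness of `U`, no temperature ceiling, uniformly in the sign of `U`. In the crux's variables: the
condensation lower bound is settled OUTSIDE the deep window `h² < U`; only `h² < U` (where
`c h² log(1/|h|)` can be `≪ U`) carries constructive content (see the reshaped skeleton
`Cruxes/TwSourcedCondensation/Lines/entropy_staircase_linear_regime.lean`, stubs (S'), (T')).

Proof (entropy staircase with CRUDE interaction slacks). `|p̃_U − p̃_0| ≤ |U|` at every temperature
(`abs_sourcedPressure_interacting_sub_free_le`: `0 ≤ Σ n↑n↓ ≤ L²`), hence the interacting sourced gain is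
`≥` the free one `− 2|U|` and the interacting dyadic heat chord is `≤` the free one `+ 2|U|`; with
`|U| ≤ h²` both slacks are `O(h²)`. On the linear window `|h|β ≤ 1` the free Cooper logarithm
(`stub_freeLinearCooperLog`, p77664) gives `c₀h² log β − (C₀+2)h²` and `log(1/(|h|+1/β)) ≤ log β`. For
`1/β < |h| ≤ 1/4` climb to the dyadic rung `β₁ = β/2^k`, `β₁|h| ≤ 1 < 2β₁|h|` (`tw_aux_minimal_rung`), use
the exact ratchet `[p̃(β₁,h) − p̃(β₁,0)] − [p̃(β₁/2,h) − p̃(β₁,h)] ≤ p̃(β,h) − p̃(β,0)`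
(`thermalRatchet_div_le`, p80167), the free logarithm at `β₁` (`log(1/(|h|+1/β)) ≤ log β₁ + 1`) and the free
heat chord `≤ C₁/β₁² ≤ 4C₁h²` (`stub_freeLinearThermalLaw`, p78799). Constants `c = c₀`,
`C = C₀ + 4C₁ + 4 + c₀`, `h₀ = 1/4`; `L₀ =` the finite maximum of the two free thresholds over the ladder
`β/2^j`, `j ≤ ⌈β⌉₊`.

Sources: Ruelle, *Statistical Mechanics* (1969) §2.5–2.6 (thermodynamic convexity in `β`); M. Salmhofer,
*Renormalization* (1999) §4.5.4 (Cooper logarithm). Tree: the two free stub files, `GibbsPressureTemperature`,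
`ThermalWedgeTwSourcedInertnessLadder`, `ThermalWedgeTwSourcedInertnessReduction`. No definition, no named fact.
-/

noncomputable section

namespace Summit.HubbardSuperconductivity.HubbardSuperconductivity.Theorems

open Matrix Finset Literature.MathematicalPhysics.QuantumLattice

/-- **The interacting sourced gain exceeds the free one up to `2|U|`**:
`[p̃(0,h) − p̃(0,0)] − 2|U| ≤ p̃(U,h) − p̃(U,0)` (every `L, μ, h`, `β > 0`). [folklore] -/
theorem sourcedGain_ge_free_sub (L : ℕ) [NeZero L] (U μ h : ℝ) {β : ℝ} (hβ : 0 < β) :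
    (Real.log (partitionFn β (dWaveSourceTorus L 0 μ h)).re / (β * (L : ℝ) ^ 2) -
        Real.log (partitionFn β (dWaveSourceTorus L 0 μ 0)).re / (β * (L : ℝ) ^ 2)) - 2 * |U| ≤
      Real.log (partitionFn β (dWaveSourceTorus L U μ h)).re / (β * (L : ℝ) ^ 2) -
        Real.log (partitionFn β (dWaveSourceTorus L U μ 0)).re / (β * (L : ℝ) ^ 2) := by
  have h1 := abs_sourcedPressure_interacting_sub_free_le L U μ h hβ
  have h2 := abs_sourcedPressure_interacting_sub_free_le L U μ 0 hβ
  rw [abs_le] at h1 h2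
  linarith [h1.1, h2.2]

/-- **The interacting dyadic heat chord exceeds the free one by at most `2|U|`**:
`[p̃_U(β/2,h) − p̃_U(β,h)] ≤ [p̃_0(β/2,h) − p̃_0(β,h)] + 2|U|` (every `L, μ, h`, `β > 0`). [folklore] -/
theorem heatChord_le_free_add (L : ℕ) [NeZero L] (U μ h : ℝ) {β : ℝ} (hβ : 0 < β) :
    Real.log (partitionFn (β / 2) (dWaveSourceTorus L U μ h)).re / (β / 2 * (L : ℝ) ^ 2) -
        Real.log (partitionFn β (dWaveSourceTorus L U μ h)).re / (β * (L : ℝ) ^ 2) ≤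
      (Real.log (partitionFn (β / 2) (dWaveSourceTorus L 0 μ h)).re / (β / 2 * (L : ℝ) ^ 2) -
        Real.log (partitionFn β (dWaveSourceTorus L 0 μ h)).re / (β * (L : ℝ) ^ 2)) + 2 * |U| := by
  have h1 := abs_sourcedPressure_interacting_sub_free_le L U μ h (half_pos hβ)
  have h2 := abs_sourcedPressure_interacting_sub_free_le L U μ h hβ
  rw [abs_le] at h1 h2
  linarith [h1.2, h2.1]

/-- **Thermal ratchet for the sourced torus** (corollary of `thermalRatchet_div_le`). For all
`L, U, μ, h` and `0 < β₁ ≤ β`: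
`[p̃(β₁,h) − p̃(β₁,0)] − [p̃(β₁/2,h) − p̃(β₁,h)] ≤ p̃(β,h) − p̃(β,0)`. [folklore] -/
theorem thermalRatchet_dWaveSource' (L : ℕ) [NeZero L] (U μ h : ℝ) {β₁ β : ℝ}
    (hβ₁ : 0 < β₁) (hle : β₁ ≤ β) :
    (Real.log (partitionFn β₁ (dWaveSourceTorus L U μ h)).re / (β₁ * (L : ℝ) ^ 2)
        - Real.log (partitionFn β₁ (dWaveSourceTorus L U μ 0)).re / (β₁ * (L : ℝ) ^ 2))
      - (Real.log (partitionFn (β₁ / 2) (dWaveSourceTorus L U μ h)).re / (β₁ / 2 * (L : ℝ) ^ 2)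
        - Real.log (partitionFn β₁ (dWaveSourceTorus L U μ h)).re / (β₁ * (L : ℝ) ^ 2))
      ≤ Real.log (partitionFn β (dWaveSourceTorus L U μ h)).re / (β * (L : ℝ) ^ 2)
        - Real.log (partitionFn β (dWaveSourceTorus L U μ 0)).re / (β * (L : ℝ) ^ 2) := by
  have hβ : 0 < β := lt_of_lt_of_le hβ₁ hle
  have hL : 0 < ((L : ℝ)) ^ 2 := cast_sq_pos_of_neZero L
  have key := thermalRatchet_div_le
    (dWaveSourceTorus_isHermitian L (isHermitian_hubbardTorusWith L 1 U μ) 0)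
    (dWaveSourceTorus_isHermitian L (isHermitian_hubbardTorusWith L 1 U μ) h) hβ₁ hle
  set L11 := Real.log (partitionFn β₁ (dWaveSourceTorus L U μ h)).re
  set L1h := Real.log (partitionFn (β₁ / 2) (dWaveSourceTorus L U μ h)).re
  set L01 := Real.log (partitionFn β₁ (dWaveSourceTorus L U μ 0)).re
  set Lb1 := Real.log (partitionFn β (dWaveSourceTorus L U μ h)).re
  set Lb0 := Real.log (partitionFn β (dWaveSourceTorus L U μ 0)).re
  have hb1 : β₁ ≠ 0 := hβ₁.ne'
  have hb : β ≠ 0 := hβ.ne'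
  have hL' : ((L : ℝ)) ^ 2 ≠ 0 := hL.ne'
  have lhs : (L11 / (β₁ * (L : ℝ) ^ 2) - L01 / (β₁ * (L : ℝ) ^ 2))
      - (L1h / (β₁ / 2 * (L : ℝ) ^ 2) - L11 / (β₁ * (L : ℝ) ^ 2))
      = ((2 * L11 - 2 * L1h - L01) / β₁) / (L : ℝ) ^ 2 := by
    field_simp
    ring
  have rhs : Lb1 / (β * (L : ℝ) ^ 2) - Lb0 / (β * (L : ℝ) ^ 2) = ((Lb1 - Lb0) / β) / (L : ℝ) ^ 2 := by
    field_simp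
  rw [lhs, rhs]
  exact div_le_div_of_nonneg_right key hL.le

/-- The cutoff logarithm is below `log β₁ + 1` when `1 < 2|h|β₁`. [folklore] -/
theorem log_cutoff_le_log_rung' {β β₁ h : ℝ} (hβ : 0 < β) (hβ₁ : 0 < β₁) (hh : 1 < |h| * (2 * β₁)) :
    Real.log (1 / (|h| + 1 / β)) ≤ Real.log β₁ + 1 := by
  have hhpos : 0 < |h| := by
    by_contra h0
    push Not at h0
    have : |h| * (2 * β₁) ≤ 0 := mul_nonpos_of_nonpos_of_nonneg h0 (by positivity)
    linarith
  have h1 : 0 < |h| + 1 / β := by positivity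
  have h2 : 1 / (|h| + 1 / β) ≤ 2 * β₁ := by
    rw [div_le_iff₀ h1]
    have : 0 < 1 / β := by positivity
    nlinarith
  calc Real.log (1 / (|h| + 1 / β)) ≤ Real.log (2 * β₁) := Real.log_le_log (by positivity) h2
    _ = Real.log 2 + Real.log β₁ := Real.log_mul (by norm_num) hβ₁.ne'
    _ ≤ Real.log β₁ + 1 := by
        have : Real.log 2 < 1 := by
          have := Real.log_two_lt_d9
          linarith
        linarith

/-- **`TwSourcedCondensation` on the shallow window `|U| ≤ h²`, unconditionally.** For every compact
`[μ₁,μ₂] ⊂ (-4,0)` there are `c C h₀ > 0` (`c = c₀` the free constant, `h₀ = 1/4`) such that for every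
`β ≥ 1` and `μ ∈ [μ₁,μ₂]`, eventually in `L` (threshold depending on `β, μ` only), for EVERY real `U`
and every `h` with `|h| ≤ h₀` and `|U| ≤ h²`:
`c h² log(1/(|h|+1/β)) − C h² ≤ p̃_L(β,U,μ,h) − p̃_L(β,U,μ,0)`.
Entropy staircase with the crude slacks `|p̃_U − p̃_0| ≤ |U| ≤ h²` in place of the constructive stubs. -/
theorem twSourcedCondensation_shallowWindow :
    ∀ μ₁ μ₂ : ℝ, -4 < μ₁ → μ₁ ≤ μ₂ → μ₂ < 0 → ∃ c C h₀ : ℝ, 0 < c ∧ 0 < C ∧ 0 < h₀ ∧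
      ∀ β : ℝ, 1 ≤ β → ∀ μ ∈ Set.Icc μ₁ μ₂, ∃ L₀ : ℕ, ∀ (L : ℕ) [NeZero L], L₀ ≤ L →
        ∀ U h : ℝ, |h| ≤ h₀ → |U| ≤ h ^ 2 →
          c * h ^ 2 * Real.log (1 / (|h| + 1 / β)) - C * h ^ 2 ≤
            Real.log (Matrix.partitionFn β
                (Literature.MathematicalPhysics.QuantumLattice.dWaveSourceTorus L U μ h)).re /
                (β * (L : ℝ) ^ 2) -
              Real.log (Matrix.partitionFn β
                (Literature.MathematicalPhysics.QuantumLattice.dWaveSourceTorus L U μ 0)).re /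
                (β * (L : ℝ) ^ 2) := by
  classical
  intro μ₁ μ₂ h4 h12 h0
  obtain ⟨c₀, C₀, hc₀, hC₀, hF⟩ := stub_freeLinearCooperLog μ₁ μ₂ h4 h12 h0
  obtain ⟨C₁, hC₁, hFh⟩ := stub_freeLinearThermalLaw μ₁ μ₂ h4 h12 h0
  refine ⟨c₀, C₀ + 4 * C₁ + 4 + c₀, 1 / 4, hc₀, by positivity, by norm_num, ?_⟩
  intro β hβ μ hμ
  have hβpos : 0 < β := by linarith
  -- total versions of the two `eventually in L` free hypotheses (at this `μ`), then choice functions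
  have hF' : ∀ β' : ℝ, ∃ L₀ : ℕ, 1 ≤ β' → ∀ (L : ℕ) [NeZero L], L₀ ≤ L → ∀ h : ℝ, |h| ≤ 1 / β' →
      c₀ * h ^ 2 * Real.log β' - C₀ * h ^ 2 ≤
        Real.log (partitionFn β' (dWaveSourceTorus L 0 μ h)).re / (β' * (L : ℝ) ^ 2) -
          Real.log (partitionFn β' (dWaveSourceTorus L 0 μ 0)).re / (β' * (L : ℝ) ^ 2) := by
    intro β'
    by_cases hb : 1 ≤ β'
    · obtain ⟨L₀, hL₀⟩ := hF β' hb μ hμ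
      exact ⟨L₀, fun _ => hL₀⟩
    · exact ⟨0, fun h1 => (hb h1).elim⟩
  have hFh' : ∀ β' : ℝ, ∃ L₀ : ℕ, 1 ≤ β' → ∀ (L : ℕ) [NeZero L], L₀ ≤ L → ∀ h : ℝ, |h| ≤ 1 / β' →
      Real.log (partitionFn (β' / 2) (dWaveSourceTorus L 0 μ h)).re / (β' / 2 * (L : ℝ) ^ 2) -
          Real.log (partitionFn β' (dWaveSourceTorus L 0 μ h)).re / (β' * (L : ℝ) ^ 2) ≤
        C₁ / β' ^ 2 := by
    intro β'
    by_cases hb : 1 ≤ β'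
    · obtain ⟨L₀, hL₀⟩ := hFh β' hb μ hμ
      exact ⟨L₀, fun _ => hL₀⟩
    · exact ⟨0, fun h1 => (hb h1).elim⟩
  choose fF hfF using hF'
  choose fFh hfFh using hFh'
  -- L₀: the largest free threshold over the dyadic ladder β / 2^j, j ≤ ⌈β⌉₊
  refine ⟨(Finset.range (⌈β⌉₊ + 1)).sup fun j => max (fF (β / 2 ^ j)) (fFh (β / 2 ^ j)), ?_⟩
  intro L _ hL U h hh hUh
  have hLj : ∀ j, j ≤ ⌈β⌉₊ → fF (β / 2 ^ j) ≤ L ∧ fFh (β / 2 ^ j) ≤ L := by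
    intro j hj
    have hmem : j ∈ Finset.range (⌈β⌉₊ + 1) := Finset.mem_range.mpr (Nat.lt_succ_of_le hj)
    have hsup := (Finset.le_sup (f := fun j => max (fF (β / 2 ^ j)) (fFh (β / 2 ^ j))) hmem).trans hL
    exact ⟨(le_max_left _ _).trans hsup, (le_max_right _ _).trans hsup⟩
  have hsq : 0 ≤ h ^ 2 := sq_nonneg h
  have hUabs : 0 ≤ |U| := abs_nonneg U
  -- notation for the pressures
  set P : ℝ → ℝ → ℝ → ℝ := fun b u s =>
    Real.log (partitionFn b (dWaveSourceTorus L u μ s)).re / (b * (L : ℝ) ^ 2) with hPdef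
  rcases le_or_gt (|h| * β) 1 with hlin | hout
  · -- Case A: inside the linear window at β itself (rung j = 0)
    have hwin : |h| ≤ 1 / β := by
      rw [le_div_iff₀ hβpos]
      exact hlin
    have h0' := hLj 0 (Nat.zero_le _)
    simp only [pow_zero, div_one] at h0'
    have h1 := hfF β hβ L h0'.1 h hwin
    have h2 := sourcedGain_ge_free_sub L U μ h hβpos
    have hlogβ : 0 ≤ Real.log β := Real.log_nonneg hβ
    have hcut : Real.log (1 / (|h| + 1 / β)) ≤ Real.log β := TwSourcedCondensation.Negative.log_cutoff_le_log hβpos h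
    have h3 : c₀ * h ^ 2 * Real.log (1 / (|h| + 1 / β)) ≤ c₀ * h ^ 2 * Real.log β :=
      mul_le_mul_of_nonneg_left hcut (by positivity)
    change c₀ * h ^ 2 * Real.log (1 / (|h| + 1 / β)) - (C₀ + 4 * C₁ + 4 + c₀) * h ^ 2 ≤
      P β U h - P β U 0
    change c₀ * h ^ 2 * Real.log β - C₀ * h ^ 2 ≤ P β 0 h - P β 0 0 at h1
    change (P β 0 h - P β 0 0) - 2 * |U| ≤ P β U h - P β U 0 at h2
    have h5 : 0 ≤ (4 * C₁ + 2 + c₀) * h ^ 2 := by positivity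
    linarith [h1, h2, h3, h5, hUh]
  · -- Case B: climb the dyadic ladder to the thermal window
    have hsmall : |h| < 1 / 2 := by linarith
    obtain ⟨k, hkK, hkspec, hone, -, hprev⟩ := tw_aux_minimal_rung one_pos hβ hsmall
    have hkpos : 0 < k := by
      rcases Nat.eq_zero_or_pos k with hk0 | hkp
      · exfalso
        rw [hk0, pow_zero, div_one] at hkspec
        linarith
      · exact hkp
    have hprev' : 1 < |h| * (2 * (β / 2 ^ k)) := hprev hkpos
    set β₁ : ℝ := β / 2 ^ k with hβ₁def
    have hβ₁pos : 0 < β₁ := by positivity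
    have hβ₁le : β₁ ≤ β := div_le_self hβpos.le (one_le_pow₀ (by norm_num))
    have hwin : |h| ≤ 1 / β₁ := by
      rw [le_div_iff₀ hβ₁pos]
      exact hkspec
    have hLk := hLj k hkK
    have h1 := hfF β₁ hone L hLk.1 h hwin
    have h2 := hfFh β₁ hone L hLk.2 h hwin
    have h3 := sourcedGain_ge_free_sub L U μ h hβ₁pos
    have h5 := heatChord_le_free_add L U μ h hβ₁pos
    have hrat := thermalRatchet_dWaveSource' L U μ h hβ₁pos hβ₁le
    have hlogβ₁ : 0 ≤ Real.log β₁ := Real.log_nonneg hone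
    have hcut : Real.log (1 / (|h| + 1 / β)) ≤ Real.log β₁ + 1 :=
      log_cutoff_le_log_rung' hβpos hβ₁pos hprev'
    -- 1/β₁² ≤ 4 h²
    have hinv : 1 / β₁ ^ 2 ≤ 4 * h ^ 2 := by
      rw [div_le_iff₀ (by positivity)]
      have h6 : 1 < (|h| * (2 * β₁)) ^ 2 := by
        have h7 : 0 ≤ |h| * (2 * β₁) := by positivity
        nlinarith
      calc (1 : ℝ) ≤ (|h| * (2 * β₁)) ^ 2 := h6.le
        _ = 4 * h ^ 2 * β₁ ^ 2 := by rw [mul_pow, mul_pow, sq_abs]; ring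
    change c₀ * h ^ 2 * Real.log (1 / (|h| + 1 / β)) - (C₀ + 4 * C₁ + 4 + c₀) * h ^ 2 ≤
      P β U h - P β U 0
    change c₀ * h ^ 2 * Real.log β₁ - C₀ * h ^ 2 ≤ P β₁ 0 h - P β₁ 0 0 at h1
    change P (β₁ / 2) 0 h - P β₁ 0 h ≤ C₁ / β₁ ^ 2 at h2
    change (P β₁ 0 h - P β₁ 0 0) - 2 * |U| ≤ P β₁ U h - P β₁ U 0 at h3
    change P (β₁ / 2) U h - P β₁ U h ≤ (P (β₁ / 2) 0 h - P β₁ 0 h) + 2 * |U| at h5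
    change (P β₁ U h - P β₁ U 0) - (P (β₁ / 2) U h - P β₁ U h) ≤ P β U h - P β U 0 at hrat
    -- the free heat chord at β₁ in terms of h²
    have hchord : P (β₁ / 2) 0 h - P β₁ 0 h ≤ 4 * C₁ * h ^ 2 := by
      have e1 : C₁ / β₁ ^ 2 = C₁ * (1 / β₁ ^ 2) := by ring
      have h8 : C₁ * (1 / β₁ ^ 2) ≤ C₁ * (4 * h ^ 2) := mul_le_mul_of_nonneg_left hinv hC₁.le
      rw [e1] at h2
      linarith [h2, h8]
    have h10 : c₀ * h ^ 2 * Real.log (1 / (|h| + 1 / β)) ≤ c₀ * h ^ 2 * (Real.log β₁ + 1) :=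
      mul_le_mul_of_nonneg_left hcut (by positivity)
    linarith [h1, h3, h5, hrat, hchord, h10, hUh]

end Summit.HubbardSuperconductivity.HubbardSuperconductivity.Theorems
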